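import Literature.Analysis.FluidPDE.BesovMildBounds
import Mathlib.Analysis.Distribution.AEEqOfIntegralContDiff
import HarnessLib

/-!
# Bounded Besov mild solutions have bounded weak representatives

Analysis/FluidPDE support file (all results proved): the assembled bridge, in the plan of
`NSCriticalClosureBesovBounded.lean`, from the hypotheses of the smoothing fact
`Literature.Analysis.FluidPDE.knss_classical_of_bounded_isBesovMildSolutionOn` to the class in
which the regularity theory of Koch–Nadirashvili–Seregin–Šverák 2009, §4 is stated:

* `IsBesovMildSolutionOn.exists_isBoundedWeakNSSolutionOn`: a Besov mild solution `(u, U)` on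
  `[0, T)` in a class `Ḃ^s_{p,q}`, `-2 < s < 0`, `1 ≤ q`, whose slices are essentially bounded
  uniformly on `(0, T₁)`, `T₁ ≤ T`, agrees slice-wise a.e. on `[0, T₁)` with a bounded weak
  solution on `ℝⁿ × (0, T₁)` in the sense of KNSS (`IsBoundedWeakNSSolutionOn`). Ingredients: the
  initial slice is bounded by the same constant (`eLpNorm_top_zero_le_of_continuousInHomBesovOn`,
  `BesovMildBounds.lean`), the slices are measurable (`IsDistributionOf.aestronglyMeasurable`),
  and `exists_isBoundedWeakNSSolutionOn_of_isMildNSSolutionOn` (`BoundedRepresentative.lean`,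
  resting on `ForwardMildWeak.lean`);
* `IsBesovMildSolutionOn.exists_isBoundedWeakNSSolutionOn_gkp`: the same in the exponents of
  Gallagher–Koch–Planchon (`s = -1 + 3/p`, `3 < p < ∞`, so that `-1 < s < 0`);
* `IsDistributionOf.ae_eq` (for the way back, `K5` of the plan): two fields with the same
  tempered distribution agree a.e. (Mathlib's `ae_eq_of_integral_contDiff_smul_eq`, the
  complexification being injective), so that a classical solution a.e. equal to the
  representative `w` at a time `t` is a.e. equal to `u t`.

## References

* G. Koch, N. Nadirashvili, G. Seregin, V. Šverák, Acta Math. 203 (2009), §4 (i)–(ii) p. 8.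
  [KochNadirashviliSereginSverak2009]
* I. Gallagher, G. S. Koch, F. Planchon, Comm. Math. Phys. 343 (2016), (1.6). [GKP2016]
-/

noncomputable section

open MeasureTheory Set Function Filter TopologicalSpace
open _root_.Topology
open scoped NNReal ENNReal SchwartzMap

namespace Literature.Analysis.FluidPDE

variable {ι : Type*} [Fintype ι]

/-- **Bounded Besov mild solutions have bounded weak representatives.** Let `(u, U)` be a Besov
mild solution on `[0, T)` in the class `(s, p, q)`, `-2 < s < 0`, `1 ≤ q`, `0 < ν`, and let
`‖u t‖_{L^∞} ≤ C < ∞` for `0 < t < T₁`, `0 < T₁ ≤ T`. Then there is a bounded weak solution `w` on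
`ℝⁿ × (0, T₁)` (KNSS 2009, §4 (ii)) with `w t = u t` a.e. for every `t ∈ [0, T₁)`. [cite: KochNadirashviliSereginSverak2009, §4 (i)–(ii) (arXiv:0709.3599 p. 8)] -/
theorem IsBesovMildSolutionOn.exists_isBoundedWeakNSSolutionOn {s T T₁ ν : ℝ} {p q : ℝ≥0∞}
    [Fact (1 ≤ p)] (hs0 : s < 0) (hs2 : -2 < s) (hq : 1 ≤ q) (hν : 0 < ν) (hT₁ : 0 < T₁)
    (hT₁T : T₁ ≤ T) {u : ℝ → EuclideanSpace ℝ ι → EuclideanSpace ℝ ι}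
    {U : ℝ → 𝓢'(EuclideanSpace ℝ ι, EuclideanSpace ℂ ι)} (hB : IsBesovMildSolutionOn s p q T ν u U)
    {C : ℝ≥0∞} (hC : C < ∞) (hb : ∀ t ∈ Ioo 0 T₁, eLpNorm (u t) ∞ volume ≤ C) :
    ∃ w : ℝ → EuclideanSpace ℝ ι → EuclideanSpace ℝ ι, (∀ t ∈ Ico 0 T₁, w t =ᵐ[volume] u t) ∧
      IsBoundedWeakNSSolutionOn (Ioo 0 T₁) isOpen_Ioo ν w := by
  -- the initial slice is bounded by the same constant
  have h0 : eLpNorm (u 0) ∞ volume ≤ C :=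
    eLpNorm_top_zero_le_of_continuousInHomBesovOn hs0 hs2 hq hT₁ hT₁T hB.continuousInHomBesovOn
      hB.isDistributionOf hC hb
  have hb' : ∀ t ∈ Ico 0 T₁, eLpNorm (u t) ∞ volume ≤ C := by
    intro t ht
    rcases eq_or_lt_of_le ht.1 with h | h
    · rw [← h]; exact h0
    · exact hb t ⟨h, ht.2⟩
  -- measurability of the slices and of the field on the sub-slab
  have hsl : ∀ t ∈ Ico 0 T₁, AEStronglyMeasurable (u t) volume := fun t ht =>
    (hB.isDistributionOf t ⟨ht.1, ht.2.trans_le hT₁T⟩).aestronglyMeasurable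
  have hmeas : AEStronglyMeasurable (uncurry u)
      ((volume : Measure (ℝ × EuclideanSpace ℝ ι)).restrict (Ioo 0 T₁ ×ˢ univ)) :=
    hB.aestronglyMeasurable.mono_measure
      (Measure.restrict_mono (prod_mono (Ioo_subset_Ioo_right hT₁T) Subset.rfl) le_rfl)
  exact exists_isBoundedWeakNSSolutionOn_of_isMildNSSolutionOn hν hT₁
    (hB.mild.mono (Ico_subset_Ico_right hT₁T)) hC hb' hsl hmeas

/-- The exponents of Gallagher–Koch–Planchon: for `3 < p < ∞`, `s_p = -1 + 3/p ∈ (-1, 0)`. [folklore] -/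
theorem gkp_index_mem_Ioo {p : ℝ≥0∞} (hp₃ : 3 < p) (hp : p < ∞) :
    -1 + 3 / p.toReal ∈ Ioo (-1 : ℝ) 0 := by
  have hp0 : (3 : ℝ) < p.toReal := by
    have h := (ENNReal.toReal_lt_toReal (by norm_num) hp.ne).2 hp₃
    simpa using h
  have hpos : 0 < p.toReal := lt_trans (by norm_num) hp0
  refine ⟨by linarith [div_pos (by norm_num : (0:ℝ) < 3) hpos], ?_⟩
  rw [neg_add_lt_iff_lt_add, add_zero, div_lt_one hpos]
  exact hp0

/-- **The same in the Gallagher–Koch–Planchon class** `(-1 + 3/p, p, q)`, `3 < p < ∞`, `1 ≤ q`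
(the class of `knss_classical_of_bounded_isBesovMildSolutionOn`): a Besov mild solution with
slices essentially bounded on `(0, T₁)` agrees slice-wise a.e. on `[0, T₁)` with a bounded weak
solution on `ℝ³ × (0, T₁)`. [cite: KochNadirashviliSereginSverak2009, §4 (i)–(ii) (arXiv:0709.3599 p. 8)] -/
theorem IsBesovMildSolutionOn.exists_isBoundedWeakNSSolutionOn_gkp {T T₁ ν : ℝ} {p q : ℝ≥0∞}
    [Fact (1 ≤ p)] (hp₃ : 3 < p) (hp : p < ∞) (hq : 1 ≤ q) (hν : 0 < ν) (hT₁ : 0 < T₁)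
    (hT₁T : T₁ ≤ T) {u : ℝ → EuclideanSpace ℝ ι → EuclideanSpace ℝ ι}
    {U : ℝ → 𝓢'(EuclideanSpace ℝ ι, EuclideanSpace ℂ ι)}
    (hB : IsBesovMildSolutionOn (-1 + 3 / p.toReal) p q T ν u U)
    {C : ℝ≥0∞} (hC : C < ∞) (hb : ∀ t ∈ Ioo 0 T₁, eLpNorm (u t) ∞ volume ≤ C) :
    ∃ w : ℝ → EuclideanSpace ℝ ι → EuclideanSpace ℝ ι, (∀ t ∈ Ico 0 T₁, w t =ᵐ[volume] u t) ∧
      IsBoundedWeakNSSolutionOn (Ioo 0 T₁) isOpen_Ioo ν w :=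
  have hs := gkp_index_mem_Ioo hp₃ hp
  hB.exists_isBoundedWeakNSSolutionOn hs.2 (by linarith [hs.1]) hq hν hT₁ hT₁T hC hb

/-! ### Fields are determined a.e. by their distributions -/

section Unique

variable {E : Type*} [NormedAddCommGroup E] [InnerProductSpace ℝ E] [FiniteDimensional ℝ E]
  [MeasurableSpace E] [BorelSpace E]

/-- **Two fields with the same tempered distribution agree a.e.**: both are locally integrable
(`IsDistributionOf.locallyIntegrable`), and for a real test function `g` the common value
`⟨U, g⟩ = complexify (∫ g • u) = complexify (∫ g • v)` gives `∫ g • u = ∫ g • v` (the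
complexification is injective); Mathlib's `ae_eq_of_integral_contDiff_smul_eq` concludes. [folklore] -/
theorem IsDistributionOf.ae_eq {u v : E → EuclideanSpace ℝ ι} {U : 𝓢'(E, EuclideanSpace ℂ ι)}
    (hu : IsDistributionOf u U) (hv : IsDistributionOf v U) : u =ᵐ[volume] v := by
  refine ae_eq_of_integral_contDiff_smul_eq hu.locallyIntegrable hv.locallyIntegrable
    fun g hg hgs => ?_
  -- the complex test function `θ = g`
  have hcs : HasCompactSupport fun y => ((g y : ℝ) : ℂ) := hgs.comp_left Complex.ofReal_zero
  have hcd : ContDiff ℝ ((⊤ : ℕ∞) : WithTop ℕ∞) fun y => ((g y : ℝ) : ℂ) :=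
    Complex.ofRealCLM.contDiff.comp hg
  set θ : 𝓢(E, ℂ) := hcs.toSchwartzMap hcd with hθ
  have hθ_apply : ∀ y, θ y = ((g y : ℝ) : ℂ) := fun y => rfl
  have hrepr : ∀ {w : E → EuclideanSpace ℝ ι}, IsDistributionOf w U →
      U θ = FunctionSpaces.EuclideanSpace.complexify (∫ y, g y • w y) := by
    intro w hw
    rw [(hw θ).2]
    have e : (fun y => θ y • FunctionSpaces.EuclideanSpace.complexify (w y)) =
        fun y => FunctionSpaces.EuclideanSpace.complexify (g y • w y) := by
      funext y
      rw [hθ_apply, map_smul, Complex.coe_smul]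
    rw [e]
    exact (FunctionSpaces.EuclideanSpace.complexify (ι := ι)).toContinuousLinearMap.integral_comp_comm
      (hw.locallyIntegrable.integrable_smul_left_of_hasCompactSupport hg.continuous hgs)
  have h := (hrepr hu).symm.trans (hrepr hv)
  exact FunctionSpaces.EuclideanSpace.complexify_injective h

end Unique

end Literature.Analysis.FluidPDE

end
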